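import Literature.AnabelianGeometry.EtaleTheta.Discharge.Sec3Prop34CnstOfRlfR
import Literature.AnabelianGeometry.EtaleTheta.Discharge.Sec3Prop34CnstOfRlfZWeak
import Literature.AlgebraicGeometry.Frobenioids.RlfStructureWeak
import HarnessLib

/-!
# [EtTh] Prop 3.4 (ii) relative to `D^cnst` for the Def. 3.6 (i) data of monoid type `ℝ` over the WEAK
# vocabulary (`RealifiedDivisorMonoids.ofRlfRWeak`): what transports from the `B₀`-level, and what does not

S. Mochizuki, *The étale theta function …*, Publ. RIMS **45** (2009) [EtTh], §3, Proposition 3.4 (ii) PDF p.74,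
Definition 3.6 (i) p.76, Theorem 3.7 (iii) pp.79–80 of `paper:doi-10-2977-prims-1234361159`
[cite: MochizukiEtTh2009, Prop 3.4 (ii) p.74]:

> "`B₀^Λ` for `B₀` (resp. `B₀^pf`; `ℝ·Φ₀^birat`) if `Λ = ℤ` (resp. `ℚ`; `ℝ`), `F₀^Λ ⊆ B₀^Λ` for `F₀`
> (resp. `F₀^pf`; `ℝ·Φ₀^cnst`)" (Def. 3.6 (i)); "(iii) … the natural action of `Aut_C(A)` on `O^▷(A)`, `O^×(A)`
> factors through `Aut_{D^cnst}(A^cnst)`. If, moreover, `Λ ∈ {ℤ, ℚ}`, then this factorization determines a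
> faithful action …" (Thm. 3.7 (iii)).

WEAK-VOCABULARY TWIN of `Discharge/Sec3Prop34CnstOfRlfR.lean` (abc-iut-w5-d130, sub-DAG
`plan/L2/SUBDAG-EtTh-Thm37.md` row «EtTh:Thm3.7(iii)/L10-R»: the `Λ = ℝ` transport
`Prop34Cnst₀ + hE ⇒ Prop34Cnst (ofRlfR dm hpf)`), proof-only, at abc-iut-L6-t12's weak constructor
`RealifiedDivisorMonoids.ofRlfRWeak dm hpf` (`RealifiedDivisorMonoidsOfRlfWeak.lean`, p424144; hypothesis
`hpf : ∀ Y, IsPerfFactorialCof (Φ₀ Y)` — abc-iut-L2-t3's repaired reading of Prop. 3.4 (i), satisfiable at the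
tempered coverings `Ÿ`, `Z_∞` with infinitely many special-fibre components where the printed Prop. 3.4 (i) and
hence `ofRlfR` are VACUOUS, cell finding F-L2d2-1).  The `B₀`-level lemma `pullGp_eq_of_mem_cnstGp` of the strong
file (a statement about the Def. 3.3 (iii) data `dm` only) is consumed BY NAME; everything else is re-proved over
THE weak realification data `realDataWeak` (`RealificationData.canonicalWeak`).  RESULT, clause by clause of
`RealifiedDivisorMonoids.Prop34Cnst (ofRlfRWeak dm hpf) cnst`, exactly as in the strong file:
* clauses 2–3 (NATURALITY of the pull-back action on `F₀^ℝ = ℝ·Φ₀^cnst` and on the log-divisors of constants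
  through `cnst : D₀ → D^cnst`) FOLLOW from `Prop34Cnst₀.B₀_map_eq_of_cnst_map_eq` by `ℝ`-linearity of the
  pull-backs of `(Φ₀^rlf)^gp` and naturality of `B₀ → Φ₀^gp → (Φ₀^rlf)^gp`
  (`pullGp_eq_of_mem_realSpan_cnstGp_weak`, `ofRlfRWeak_BΛ_map_eq`, `ofRlfRWeak_ΦR_map_eq`);
* clause 4 (faithfulness for `Λ ∈ {ℤ, ℚ}`) is VACUOUS at `Λ = ℝ` (`ofRlfRWeak_cnst_map_eq`);
* clause 1 — "an element of `B₀^ℝ(Y) = ℝ·Φ₀^birat(Y)` with EFFECTIVE image in `(Φ₀^ℝ)^gp(Y)` lies in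
  `F₀^ℝ(Y) = ℝ·Φ₀^cnst(Y)`" — enters BY NAME as the hypothesis `hE` (not a formal consequence of the `B₀`-level
  data: `Discharge/Sec3Prop34CnstOfRlfRNegative.lean`), and `eff_of_prop34Cnst_ofRlfRWeak` shows it is EXACTLY
  the residual;
* `Prop34Cnst.ofRlfRWeak_of_eff` assembles; `TemperedFrobenioid.thm37_iii_withCnst_ofRlfRWeak` — Theorem 3.7
  (iii), as typed, for every tempered Frobenioid over the weak `Λ = ℝ` data, modulo `Prop34Cnst₀` and `hE`.
Seat abc-iut-L6-t12 (gen 4), cell abc-iut, row «§3 WEAK COLUMN at Λ = ℚ/ℝ» piece (W2-R).  PROOF-ONLY: no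
definition, no named fact, nothing of abc-iut-w5-d130's file edited or restated.  HONEST FRAMING: refereed
pre-IUT material ([EtTh] 2009); nothing here bears on [IUTchIII] Cor. 3.12; no statement of the paper is
strengthened; typed ≠ proved — clause 1 for `Λ = ℝ` stays a named hypothesis.
-/

noncomputable section

namespace Literature.AnabelianGeometry.EtaleTheta

open CategoryTheory Opposite Literature.AlgebraicGeometry.Frobenioids

universe u₀ v₀ u₁ v₁ u v w

namespace RealifiedDivisorMonoids.Prop34Cnst

variable {D₀ : Type u} [Category.{v} D₀] {dm : DivisorMonoids.{u, v, w} D₀}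
  {hpf : ∀ Y : D₀ᵒᵖ, IsPerfFactorialCof (dm.Φ₀.obj Y)}
  {Dcnst : Type u₁} [Category.{v₁} Dcnst] {cnst : D₀ ⥤ Dcnst}

/-! ### The `B₀`-level naturality clause transports to `ℝ·Φ₀^cnst` (weak realification data) -/

/-- Morphisms `g, g' : Y → Y'` of `D₀` with the same image in `D^cnst` pull back every element of
`ℝ·Φ₀^cnst(Y') ⊆ (Φ₀^rlf)^gp(Y')` identically, for THE WEAK realification data: the generators `r • ι(c)` go to
`r • ι(g^* c)` (`ℝ`-linearity of the pull-backs, naturality of `ι : Φ₀^gp → (Φ₀^rlf)^gp`, and the strong file's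
`B₀`-level `pullGp_eq_of_mem_cnstGp` BY NAME). [cite: MochizukiEtTh2009, Prop 3.4 (ii) p.74] -/
theorem pullGp_eq_of_mem_realSpan_cnstGp_weak (h₀ : dm.Prop34Cnst₀ cnst) {Y Y' : D₀} (g g' : Y ⟶ Y')
    (hg : cnst.map g = cnst.map g')
    {x : Algebra.GrothendieckGroup ((realDataWeak dm hpf).rlf.obj (op Y'))}
    (hx : x ∈ ((realDataWeak dm hpf).realSpan dm.cnstGp).carrier Y') :
    pullGp (realDataWeak dm hpf).rlf g x = pullGp (realDataWeak dm hpf).rlf g' x := by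
  suffices hle : ((realDataWeak dm hpf).realSpan dm.cnstGp).carrier Y' ≤
      (pullGp (realDataWeak dm hpf).rlf g).eqLocus (pullGp (realDataWeak dm hpf).rlf g') from hle hx
  refine (Subgroup.closure_le _).mpr ?_
  rintro _ ⟨r, c, hc, rfl⟩
  change pullGp (realDataWeak dm hpf).rlf g
      ((realDataWeak dm hpf).rsmul Y' r ((realDataWeak dm hpf).toRlfGp Y' c)) =
    pullGp (realDataWeak dm hpf).rlf g'
      ((realDataWeak dm hpf).rsmul Y' r ((realDataWeak dm hpf).toRlfGp Y' c))
  rw [(realDataWeak dm hpf).pullGp_rsmul g, (realDataWeak dm hpf).pullGp_rsmul g',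
    ← (realDataWeak dm hpf).toRlfGp_pullGp g, ← (realDataWeak dm hpf).toRlfGp_pullGp g',
    pullGp_eq_of_mem_cnstGp h₀ g g' hg hc]

/-! ### Clauses 2–4 of `Prop34Cnst (ofRlfRWeak dm hpf)` -/

/-- **Clause 2 for `Λ = ℝ` (weak data)**: the pull-back action of `D₀` on the constants `F₀^ℝ = ℝ·Φ₀^cnst ⊆
B₀^ℝ = ℝ·Φ₀^birat` factors through `cnst : D₀ → D^cnst`. [cite: MochizukiEtTh2009, Prop 3.4 (ii) p.74] -/
theorem ofRlfRWeak_BΛ_map_eq (h₀ : dm.Prop34Cnst₀ cnst) {Y Y' : D₀} (g g' : Y ⟶ Y')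
    (hg : cnst.map g = cnst.map g') (b : (ofRlfRWeak dm hpf).BΛ.obj (op Y'))
    (hb : b ∈ (ofRlfRWeak dm hpf).FΛ (op Y')) :
    ((ofRlfRWeak dm hpf).BΛ.map g.op).hom b = ((ofRlfRWeak dm hpf).BΛ.map g'.op).hom b :=
  Subtype.ext (pullGp_eq_of_mem_realSpan_cnstGp_weak h₀ g g' hg hb)

/-- **Clause 3 for `Λ = ℝ` (weak data)**: so does the pull-back action of `D₀` on the elements of
`Φ₀^ℝ(Y') = Φ₀(Y')^rlf` which are (effective) log-divisors of elements of `F₀^ℝ(Y')` (the weak `Φ₀(Y)^rlf` is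
integral, `IsPerfFactorialWeak.Rlf.isIntegral`). [cite: MochizukiEtTh2009, Prop 3.4 (ii) p.74] -/
theorem ofRlfRWeak_ΦR_map_eq (h₀ : dm.Prop34Cnst₀ cnst) {Y Y' : D₀} (g g' : Y ⟶ Y')
    (hg : cnst.map g = cnst.map g') (x : (ofRlfRWeak dm hpf).ΦR.obj (op Y'))
    (hx : ∃ b ∈ (ofRlfRWeak dm hpf).FΛ (op Y'),
      (ofRlfRWeak dm hpf).divΛ (op Y') b = Algebra.GrothendieckGroup.of x) :
    ((ofRlfRWeak dm hpf).ΦR.map g.op).hom x = ((ofRlfRWeak dm hpf).ΦR.map g'.op).hom x := by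
  obtain ⟨b, hb, hbx⟩ := hx
  apply (IsPerfFactorialWeak.Rlf.isIntegral (hpf (op Y)).weak).injective_of
  have h := pullGp_eq_of_mem_realSpan_cnstGp_weak h₀ g g' hg hb
  change MonGp.map ((ofRlfRWeak dm hpf).ΦR.map g.op).hom ((ofRlfRWeak dm hpf).divΛ (op Y') b) =
    MonGp.map ((ofRlfRWeak dm hpf).ΦR.map g'.op).hom ((ofRlfRWeak dm hpf).divΛ (op Y') b) at h
  rw [hbx, MonGp.map_of, MonGp.map_of] at h
  exact h

/-- **Clause 4 is vacuous for `Λ = ℝ`** (weak data; the faithfulness clause concerns `Λ ∈ {ℤ, ℚ}` only, as in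
print: "If, moreover, `Λ ∈ {ℤ, ℚ}` …", p.80). [cite: MochizukiEtTh2009, Thm 3.7 (iii) p.80] -/
theorem ofRlfRWeak_cnst_map_eq
    (hΛ : (ofRlfRWeak dm hpf).Λ = MonoidType.Z ∨ (ofRlfRWeak dm hpf).Λ = MonoidType.Q)
    {Y : D₀} (g g' : Y ≅ Y) : cnst.map g.hom = cnst.map g'.hom := by
  rcases hΛ with h | h <;> exact absurd h (by rw [ofRlfRWeak_Λ]; decide)

/-! ### Clause 1 as the exact residual, and the assembly -/

/-- **`Prop34Cnst (ofRlfRWeak dm hpf) cnst` from the `B₀`-level naturality clauses and the `Λ = ℝ`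
effective-locus clause BY NAME** (`hE`: "an element of `ℝ·Φ₀^birat(Y)` whose image in `(Φ₀^rlf)^gp(Y)` is [the
class of] an element of `Φ₀(Y)^rlf` lies in `ℝ·Φ₀^cnst(Y)`", for THE weak realification data).
[cite: MochizukiEtTh2009, Prop 3.4 (ii) p.74] -/
theorem ofRlfRWeak_of_eff (h₀ : dm.Prop34Cnst₀ cnst)
    (hE : ∀ (Y : D₀) (b : Algebra.GrothendieckGroup ((realDataWeak dm hpf).rlf.obj (op Y)))
      (x : (hpf (op Y)).weak.Rlf),
      b ∈ ((realDataWeak dm hpf).realSpan dm.biratGp).carrier Y → b = Algebra.GrothendieckGroup.of x →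
        b ∈ ((realDataWeak dm hpf).realSpan dm.cnstGp).carrier Y) :
    (ofRlfRWeak dm hpf).Prop34Cnst cnst where
  mem_FΛ_of_divΛ_eq_of Y b x hbx := hE (unop Y) b.1 x b.2 hbx
  BΛ_map_eq_of_cnst_map_eq g g' hg b hb := ofRlfRWeak_BΛ_map_eq h₀ g g' hg b hb
  ΦR_map_eq_of_cnst_map_eq g g' hg x hx := ofRlfRWeak_ΦR_map_eq h₀ g g' hg x hx
  cnst_map_eq_of_BΛ_map_eq hΛ _ g g' _ := ofRlfRWeak_cnst_map_eq hΛ g g'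

/-- Conversely clause 1 of `Prop34Cnst (ofRlfRWeak dm hpf) cnst` IS the hypothesis `hE` (so `hE` is exactly the
residual, neither weaker nor stronger). [cite: MochizukiEtTh2009, Prop 3.4 (ii) p.74] -/
theorem eff_of_prop34Cnst_ofRlfRWeak (h : (ofRlfRWeak dm hpf).Prop34Cnst cnst) (Y : D₀)
    (b : Algebra.GrothendieckGroup ((realDataWeak dm hpf).rlf.obj (op Y))) (x : (hpf (op Y)).weak.Rlf)
    (hb : b ∈ ((realDataWeak dm hpf).realSpan dm.biratGp).carrier Y) (hbx : b = Algebra.GrothendieckGroup.of x) :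
    b ∈ ((realDataWeak dm hpf).realSpan dm.cnstGp).carrier Y :=
  h.mem_FΛ_of_divΛ_eq_of (op Y) ⟨b, hb⟩ x hbx

/-- The `Λ = ℝ` weak data packaged from abc-iut-L2-t3's typed Prop 3.4 over the weak vocabulary
(`ofRlfRWeakOfProp34`): `Prop34Cnst` ⇐ {`Prop34Cnst₀`, `hE`} — literally `ofRlfRWeak_of_eff`.
[cite: MochizukiEtTh2009, Prop 3.4 (ii) p.74] -/
theorem ofRlfRWeakOfProp34_of_eff {V₀ : FrdICatStub.{u, v, w} D₀} (h34 : dm.Prop34 treeMonoidVocabWeak.{w} V₀)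
    (h₀ : dm.Prop34Cnst₀ cnst)
    (hE : ∀ (Y : D₀) (b : Algebra.GrothendieckGroup ((realDataWeak dm h34.isPerfFactorial).rlf.obj (op Y)))
      (x : (h34.isPerfFactorial (op Y)).weak.Rlf),
      b ∈ ((realDataWeak dm h34.isPerfFactorial).realSpan dm.biratGp).carrier Y →
        b = Algebra.GrothendieckGroup.of x →
        b ∈ ((realDataWeak dm h34.isPerfFactorial).realSpan dm.cnstGp).carrier Y) :
    (ofRlfRWeakOfProp34 dm h34).Prop34Cnst cnst :=
  ofRlfRWeak_of_eff h₀ hE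

end RealifiedDivisorMonoids.Prop34Cnst

/-! ### Theorem 3.7 (iii) over the constructed `Λ = ℝ` weak data -/

namespace TemperedFrobenioid

variable {D₀ : Type u} [Category.{v} D₀] {dm : DivisorMonoids.{u, v, w} D₀}
  {hpf : ∀ Y : D₀ᵒᵖ, IsPerfFactorialCof (dm.Φ₀.obj Y)}
  {D : Type u₀} [Category.{v₀} D] {VD : FrdICatStub.{u₀, v₀, w} D}
  (C₀ : TemperedFrobenioid (RealifiedDivisorMonoids.ofRlfRWeak dm hpf) D VD)
  {Dcnst : Type u₁} [Category.{v₁} Dcnst] {cnst : D₀ ⥤ Dcnst}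

/-- **Theorem 3.7 (iii) for a tempered Frobenioid of monoid type `ℝ` over the CONSTRUCTED weak Def. 3.6 (i)
data `ofRlfRWeak dm hpf`**, at the instantiated facade, modulo the `B₀`-level naturality clauses
`dm.Prop34Cnst₀ cnst` and the `Λ = ℝ` effective-locus clause `hE` BY NAME — the weak twin of
`thm37_iii_withCnst_ofRlfR`. [cite: MochizukiEtTh2009, Thm 3.7 (iii) p.79] -/
theorem thm37_iii_withCnst_ofRlfRWeak (F : FrobenioidFacade.{u₀, v₀, w} D) (h₀ : dm.Prop34Cnst₀ cnst)
    (hE : ∀ (Y : D₀)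
      (b : Algebra.GrothendieckGroup ((RealifiedDivisorMonoids.realDataWeak dm hpf).rlf.obj (op Y)))
      (x : (hpf (op Y)).weak.Rlf),
      b ∈ ((RealifiedDivisorMonoids.realDataWeak dm hpf).realSpan dm.biratGp).carrier Y →
        b = Algebra.GrothendieckGroup.of x →
        b ∈ ((RealifiedDivisorMonoids.realDataWeak dm hpf).realSpan dm.cnstGp).carrier Y) :
    TemperedFrobenioid.Thm37_iii (T := RealifiedDivisorMonoids.ofRlfRWeak dm hpf) C₀
      (F.withCnst (C₀.base ⋙ cnst)) :=
  C₀.thm37_iii_withCnst F (RealifiedDivisorMonoids.Prop34Cnst.ofRlfRWeak_of_eff h₀ hE)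

end TemperedFrobenioid

end Literature.AnabelianGeometry.EtaleTheta

end
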